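import Mathlib
import Literature.Geometry.Lorentzian.KerrData
import HarnessLib

/-!
# SchwarzschildKillingAlgebra

Topic `Literature/Geometry/Lorentzian`. Named literature fact written for the Summits helper file
`Summits/FinalStateConjecture/FinalStateConjecture/Theorems/ZeroEnergyKerrOrBombStationaryLimitReductionKerrIsometryRigidityWave3Facts.lean`
(stub `stub_kerrIsometryRigidity` of crux stmt-FinalStateConjecture-10021, line `symplectic-dual-of-the-bomb`,
wave 3; cited proposition stated in the tree's Kerr–Schild vocabulary, the `a = 0` companion of
`Literature.Geometry.Lorentzian.ONeill1995_kerrKillingFields` in `KerrKillingAlgebra.lean`).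
Sources: StephaniEtAl2003.

* `Literature.Geometry.Lorentzian.StephaniEtAl2003_schwarzschildKillingFields`
-/

namespace Literature.Geometry.Lorentzian

open scoped Manifold ContDiff Topology RealInnerProductSpace
open Set Filter Function

/-- **Stephani–Kramer–MacCallum–Hoenselaers–Herlt: the Killing algebra of the Schwarzschild exterior is
`ℝ ∂_t ⊕ so(3)`** (named fact, D-0014; the `a = 0` companion of `ONeill1995_kerrKillingFields`, stated
inline in the tree's vocabulary for the exterior block in ingoing Kerr–Schild coordinates, WEAKER than print).

Printed sources. H. Stephani, D. Kramer, M. MacCallum, C. Hoenselaers, E. Herlt, *Exact Solutions of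
Einstein's Field Equations*, 2nd ed., CUP (2003): §15.4, Theorem 15.5 and (15.19) — the Schwarzschild
solution admits, besides the group `G₃` of rotations on the orbit spheres, "an additional timelike …
Killing vector `ξ = ∂_t` … which is hypersurface-orthogonal and commutes with the three generators of
`G₃`", i.e. a `G₄`; §38.2 (after Table 38.1, maximal groups of motions of the algebraically special vacuum
fields, Kinnersley 1969, Kerr–Debney 1970): "The type D vacuum solutions admit either a `G₂` or a `G₄`" —
so the MAXIMAL (local) group of motions of Schwarzschild (`m ≠ 0`, type D) is this `G₄`, and on the simply
connected exterior block every Killing vector field is a constant-coefficient combination of `∂_t` and the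
three rotation generators `xⁱ ∂_j − xʲ ∂_i`.

What is vendored. For `M > 0`, on the Schwarzschild exterior `Kerr.exterior M 0 = {‖x⃗‖ > 2M}` in ingoing
Eddington–Finkelstein/Kerr–Schild Cartesian coordinates (`g = η + (2M/r) ℓ ⊗ ℓ`, in which `∂_t = ∂_{t*}`
has constant components `e₀` and the rotations act linearly on the spatial coordinates), every Killing
field `X` of `Kerr.smoothMetric M 0 r₊` in the tree's sense (`PseudoRiemannianMetric.IsKillingField`, under
the standing hypothesis `[HasLeviCivita]`) is `X = α ∂_{t*} + W`, `W(t*, x⃗) = (0, W₀ x⃗)` for a constant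
`α` and a constant skew-adjoint linear map `W₀` of `ℝ³` (an element of `so(3)`, `W₀ x⃗ = ω × x⃗`).
Nothing is claimed for `M ≤ 0` or about completeness of `X`.
[cite: StephaniEtAl2003, §38.2 (after Table 38.1) with §15.4 (15.19)]
[file Geometry/Lorentzian/SchwarzschildKillingAlgebra] -/
def StephaniEtAl2003_schwarzschildKillingFields : Prop :=
  ∀ [Kerr.Facts] (M : ℝ) [(Kerr.smoothMetric M 0 (Kerr.rPlus M 0)).HasLeviCivita], 0 < M →
    ∀ X : Π x : Kerr.exterior M 0, TangentSpace 𝓘(ℝ, E4) x,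
      (Kerr.smoothMetric M 0 (Kerr.rPlus M 0)).toPseudoRiemannianMetric.IsKillingField X →
      ∃ (α : ℝ) (W₀ : E3 →L[ℝ] E3), (∀ u v : E3, ⟪W₀ u, v⟫ = -⟪u, W₀ v⟫) ∧
        ∀ x : Kerr.exterior M 0,
          (X x : E4) = α • E4.basisVector 0 + E4.ofTimeSpace 0 (W₀ (E4.spatial x.1))

end Literature.Geometry.Lorentzian
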